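import Literature.MathematicalPhysics.QuantumLattice.DWaveSourceFreePressure
import Literature.MathematicalPhysics.QuantumLattice.DWaveSourceProofs
import Literature.MathematicalPhysics.QuantumLattice.LiebFluxPhaseProofs
import Literature.MathematicalPhysics.QuantumLattice.TorusCooperSum

/-!
# The free Hubbard torus at `T = 0`: grand-canonical ground energy `2 Σ_k min(ε_L(k) - μ, 0)`
# and the secant inequalities in the chemical potential

Topic `MathematicalPhysics/QuantumLattice` (family `hubbard`). Written for the chemical-potential
localisation step of the support item `TwPureThermalBound` (route `HubbardSuperconductivity/ThermalWedge`:
the subgradient `μ` of the interacting canonical ground-energy density at density `1 - δ` must lie in a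
`δ`-uniform window `[μ₁, μ₂] ⊂ (-4, 0)` for all small `U ≥ 0`), and reusable for the density clause of
`Literature/MathematicalPhysics/QuantumLattice/HubbardGrandCanonicalDensity.lean`. For the FREE model
(`U = 0`, hopping `t = 1`) on the torus `(ℤ/Lℤ)²`, `K⁰_μ := hubbardTorusWith 2 L 1 0 μ`, we PROVE:

* `groundEnergy_hubbardTorusWith_zero` (`L ≥ 3`): `E₀(K⁰_μ) = 2 Σ_{k ∈ (ℤ/Lℤ)²} min(ε_L(k) - μ, 0)` —
  fill every level below `μ` with both spins. Proof: the tree's BdG partition function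
  `partitionFn_dWaveSourceTorus_zero` at source `s = 0` is `2^{2L²} Π_k e^{-βξ_k}(1 + cosh β|ξ_k|)/2`,
  whose logarithm is `-2β Σ_k min(ξ_k, 0) + O(L²)` uniformly in `β` (`log_partitionFn_hubbardTorusWith_zero_mem_Icc`),
  and `e^{-βE₀} ≤ Re Z_β ≤ 4^{L²} e^{-βE₀}` (`LiebFluxPhaseProofs`); let `β → ∞`.
* the two **secant inequalities** in `μ` (`μ' ≤ μ`):
  `E₀(K⁰_μ) ≤ E₀(K⁰_{μ'}) - 2(μ - μ')·#{k : ε_L(k) < μ'}` (`groundEnergy_free_le_sub_card`) and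
  `E₀(K⁰_{μ'}) ≤ E₀(K⁰_μ) + 2(μ - μ')·#{k : ε_L(k) < μ}` (`groundEnergy_free_le_add_card`) — the number of
  levels below the chemical potential is a super/sub-gradient of the concave `μ ↦ E₀(K⁰_μ)`.

The level counts at the band edges and the resulting explicit window are in
`TorusBandEdgeCounting.lean` and `HubbardTorusChemicalPotentialWindow.lean`. Everything is proved; no
definition and no named fact.

## References

* D. Ruelle, *Statistical Mechanics: Rigorous Results* (Benjamin, 1969), §3.4 (chemical potential and
  density; concavity of the grand potential). [folklore use]
* J. von Delft, D. C. Ralph, Phys. Rep. 345 (2001) 61, §4.2 (the BdG partition function used at `s = 0`).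
  [VondelftRalph2001]
-/

noncomputable section

namespace Literature.MathematicalPhysics.QuantumLattice

open Matrix Finset Real Literature.Probability.LatticeModels

variable {L : ℕ} [NeZero L]

/-! ### Elementary bounds -/

/-- `e^y / 4 ≤ (1 + cosh y)/2` for every real `y`. [folklore] -/
theorem exp_div_four_le_one_add_cosh_div_two (y : ℝ) : Real.exp y / 4 ≤ (1 + Real.cosh y) / 2 := by
  rw [Real.cosh_eq]
  have h1 : 0 < Real.exp (-y) := Real.exp_pos _
  linarith

/-- `(1 + cosh y)/2 ≤ e^y` for `0 ≤ y`. [folklore] -/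
theorem one_add_cosh_div_two_le_exp {y : ℝ} (hy : 0 ≤ y) : (1 + Real.cosh y) / 2 ≤ Real.exp y := by
  rw [Real.cosh_eq]
  have h1 : Real.exp (-y) ≤ Real.exp y := Real.exp_le_exp.2 (by linarith)
  have h2 : 1 ≤ Real.exp y := Real.one_le_exp hy
  linarith

/-- `-ξ + |ξ| = -2 min(ξ, 0)`. [folklore] -/
theorem neg_add_abs_eq (ξ : ℝ) : -ξ + |ξ| = -2 * min ξ 0 := by
  rcases le_or_gt ξ 0 with h | h
  · rw [min_eq_left h, abs_of_nonpos h]; ring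
  · rw [min_eq_right h.le, abs_of_pos h]; ring

/-! ### The free grand-canonical ground energy of the torus -/

/-- The per-mode factor of the free partition function at `s = 0`, in logarithm:
`-βξ + β|ξ| - log 4 ≤ log(e^{-βξ}(1 + cosh(β|ξ|))/2) ≤ -βξ + β|ξ|` for `β ≥ 0`. [folklore] -/
theorem log_freeModeFactor_mem_Icc {β : ℝ} (hβ : 0 ≤ β) (ξ : ℝ) :
    Real.log (Real.exp (-(β * ξ)) * ((1 + Real.cosh (β * |ξ|)) / 2)) ∈
      Set.Icc (-(β * ξ) + β * |ξ| - Real.log 4) (-(β * ξ) + β * |ξ|) := by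
  have hy : 0 ≤ β * |ξ| := mul_nonneg hβ (abs_nonneg ξ)
  have hc : 0 < (1 + Real.cosh (β * |ξ|)) / 2 := by
    have := Real.one_le_cosh (β * |ξ|); positivity
  rw [Real.log_mul (Real.exp_pos _).ne' hc.ne', Real.log_exp]
  constructor
  · have h := exp_div_four_le_one_add_cosh_div_two (β * |ξ|)
    have h' : Real.log (Real.exp (β * |ξ|) / 4) ≤ Real.log ((1 + Real.cosh (β * |ξ|)) / 2) :=
      Real.log_le_log (by positivity) h
    rw [Real.log_div (Real.exp_pos _).ne' (by norm_num), Real.log_exp] at h'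
    linarith
  · have h := one_add_cosh_div_two_le_exp hy
    have h' : Real.log ((1 + Real.cosh (β * |ξ|)) / 2) ≤ Real.log (Real.exp (β * |ξ|)) :=
      Real.log_le_log hc h
    rw [Real.log_exp] at h'
    linarith

/-- **The free partition function in logarithm**: for `L ≥ 3`, `β ≥ 0`,
`log Re Z_β(hubbardTorusWith 2 L 1 0 μ) ∈ [2L² log 2 - 2β Σ_k min(ξ_k,0) - L² log 4, 2L² log 2 - 2β Σ_k min(ξ_k,0)]`,
`ξ_k = ε_L(k) - μ` (from the BdG formula `partitionFn_dWaveSourceTorus_zero` at `s = 0`). [folklore] -/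
theorem log_partitionFn_hubbardTorusWith_zero_mem_Icc (hL : 3 ≤ L) {β : ℝ} (hβ : 0 ≤ β) (μ : ℝ) :
    Real.log (partitionFn β (hubbardTorusWith 2 L 1 0 μ)).re ∈
      Set.Icc (2 * (L : ℝ) ^ 2 * Real.log 2 - 2 * β * ∑ k : TorusSite 2 L, min (torusBand L k - μ) 0
          - (L : ℝ) ^ 2 * Real.log 4)
        (2 * (L : ℝ) ^ 2 * Real.log 2 - 2 * β * ∑ k : TorusSite 2 L, min (torusBand L k - μ) 0) := by
  have hZ := partitionFn_dWaveSourceTorus_zero_re hL β μ 0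
  rw [dWaveSourceTorus_zero] at hZ
  have hsimp : ∀ k : TorusSite 2 L, Real.sqrt ((torusBand L k - μ) ^ 2 + (2 * Real.sqrt 2 * 0 * dWaveGap k) ^ 2) =
      |torusBand L k - μ| := fun k => by
    rw [mul_zero, zero_mul, zero_pow two_ne_zero, add_zero, Real.sqrt_sq_eq_abs]
  simp_rw [hsimp] at hZ
  rw [hZ, card_orb_fermionTorus_two]
  have hpow : (0 : ℝ) < (2 : ℝ) ^ (2 * L ^ 2) := by positivity
  have hfac : ∀ k : TorusSite 2 L, Real.exp (-(β * (torusBand L k - μ))) *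
      ((1 + Real.cosh (β * |torusBand L k - μ|)) / 2) ≠ 0 := fun k => by
    have := Real.one_le_cosh (β * |torusBand L k - μ|); positivity
  rw [Real.log_mul hpow.ne' (Finset.prod_ne_zero_iff.2 fun k _ => hfac k),
    Real.log_prod (s := Finset.univ) (hf := fun k _ => hfac k), Real.log_pow]
  have hsum := fun k : TorusSite 2 L => log_freeModeFactor_mem_Icc hβ (torusBand L k - μ)
  have hlo : ∑ k : TorusSite 2 L, (-(β * (torusBand L k - μ)) + β * |torusBand L k - μ| - Real.log 4) ≤
      ∑ k : TorusSite 2 L, Real.log (Real.exp (-(β * (torusBand L k - μ))) *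
        ((1 + Real.cosh (β * |torusBand L k - μ|)) / 2)) := Finset.sum_le_sum fun k _ => (hsum k).1
  have hhi : ∑ k : TorusSite 2 L, Real.log (Real.exp (-(β * (torusBand L k - μ))) *
        ((1 + Real.cosh (β * |torusBand L k - μ|)) / 2)) ≤
      ∑ k : TorusSite 2 L, (-(β * (torusBand L k - μ)) + β * |torusBand L k - μ|) :=
    Finset.sum_le_sum fun k _ => (hsum k).2
  have hid : ∀ k : TorusSite 2 L, -(β * (torusBand L k - μ)) + β * |torusBand L k - μ| =
      -2 * β * min (torusBand L k - μ) 0 := fun k => by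
    have := neg_add_abs_eq (torusBand L k - μ)
    linear_combination β * this
  simp_rw [Finset.sum_sub_distrib, hid, Finset.sum_const, Finset.card_univ, card_torusSite_two,
    nsmul_eq_mul, ← Finset.mul_sum] at hlo hhi
  have hcast : ((2 * L ^ 2 : ℕ) : ℝ) = 2 * (L : ℝ) ^ 2 := by push_cast; ring
  rw [hcast]
  constructor
  · push_cast at hlo; linarith
  · linarith

/-- **The grand-canonical ground energy of the free Hubbard torus** (`t = 1`, `U = 0`, `L ≥ 3`):
`E₀(hubbardTorusWith 2 L 1 0 μ) = 2 Σ_{k ∈ (ℤ/Lℤ)²} min(ε_L(k) - μ, 0)` — fill the levels below `μ`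
with both spins (from the partition function by `β → ∞`: `e^{-βE₀} ≤ Re Z ≤ 4^{L²} e^{-βE₀}`). [folklore] -/
theorem groundEnergy_hubbardTorusWith_zero (hL : 3 ≤ L) (μ : ℝ) :
    (hubbardTorusWith 2 L 1 0 μ).groundEnergy = 2 * ∑ k : TorusSite 2 L, min (torusBand L k - μ) 0 := by
  set H := hubbardTorusWith 2 L 1 0 μ with hH
  set S := ∑ k : TorusSite 2 L, min (torusBand L k - μ) 0 with hS
  have hHerm : H.IsHermitian := isHermitian_hubbardTorusWith L 1 0 μ
  have hcard : (Fintype.card (Finset (Orb (FermionTorus 2 L))) : ℝ) = (2 : ℝ) ^ (2 * L ^ 2) := by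
    rw [Fintype.card_finset, card_orb_fermionTorus_two]; push_cast; ring
  -- for every β > 0: |E₀ - 2S| ≤ 2 L² log 2 / β
  have key : ∀ β : ℝ, 0 < β → H.groundEnergy ≤ 2 * S + 2 * (L : ℝ) ^ 2 * Real.log 2 / β ∧
      2 * S - 2 * (L : ℝ) ^ 2 * Real.log 2 / β ≤ H.groundEnergy := by
    intro β hβ
    have h1 := exp_neg_mul_groundEnergy_le_partitionFn hHerm β
    have h2 := partitionFn_le_card_mul_exp hHerm hβ.le
    have hZpos : 0 < (partitionFn β H).re := lt_of_lt_of_le (Real.exp_pos _) h1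
    have hl1 : -(β * H.groundEnergy) ≤ Real.log (partitionFn β H).re := by
      rw [← Real.log_exp (-(β * H.groundEnergy))]
      exact Real.log_le_log (Real.exp_pos _) h1
    have hl2 : Real.log (partitionFn β H).re ≤ 2 * (L : ℝ) ^ 2 * Real.log 2 - β * H.groundEnergy := by
      have h := Real.log_le_log hZpos h2
      rw [Real.log_mul (by positivity) (Real.exp_pos _).ne', Real.log_exp, hcard, Real.log_pow] at h
      push_cast at h
      linarith
    have hb := log_partitionFn_hubbardTorusWith_zero_mem_Icc hL hβ.le μ
    rw [← hH, ← hS] at hb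
    have hlog4 : Real.log 4 = 2 * Real.log 2 := by
      rw [show (4 : ℝ) = 2 ^ 2 by norm_num, Real.log_pow]; push_cast; ring
    rw [hlog4] at hb
    obtain ⟨hb1, hb2⟩ := hb
    constructor
    · -- from hb1 and hl2
      have h : β * H.groundEnergy ≤ 2 * β * S + 2 * (L : ℝ) ^ 2 * Real.log 2 := by nlinarith
      have h' : H.groundEnergy ≤ (2 * β * S + 2 * (L : ℝ) ^ 2 * Real.log 2) / β := by
        rw [le_div_iff₀ hβ]; linarith
      calc H.groundEnergy ≤ (2 * β * S + 2 * (L : ℝ) ^ 2 * Real.log 2) / β := h'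
        _ = 2 * S + 2 * (L : ℝ) ^ 2 * Real.log 2 / β := by field_simp
    · have h : 2 * β * S - 2 * (L : ℝ) ^ 2 * Real.log 2 ≤ β * H.groundEnergy := by nlinarith
      have h' : (2 * β * S - 2 * (L : ℝ) ^ 2 * Real.log 2) / β ≤ H.groundEnergy := by
        rw [div_le_iff₀ hβ]; linarith
      calc 2 * S - 2 * (L : ℝ) ^ 2 * Real.log 2 / β = (2 * β * S - 2 * (L : ℝ) ^ 2 * Real.log 2) / β := by
            field_simp
        _ ≤ H.groundEnergy := h'
  have hc : 0 ≤ 2 * (L : ℝ) ^ 2 * Real.log 2 := by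
    have := Real.log_nonneg (show (1 : ℝ) ≤ 2 by norm_num); positivity
  refine le_antisymm ?_ ?_
  · refine le_of_forall_pos_le_add fun ε hε => ?_
    obtain ⟨h, -⟩ := key ((2 * (L : ℝ) ^ 2 * Real.log 2 + 1) / ε) (by positivity)
    calc H.groundEnergy ≤ 2 * S + 2 * (L : ℝ) ^ 2 * Real.log 2 / ((2 * (L : ℝ) ^ 2 * Real.log 2 + 1) / ε) := h
      _ ≤ 2 * S + ε := by
          gcongr
          rw [div_div_eq_mul_div, div_le_iff₀ (by positivity)]
          nlinarith
  · refine le_of_forall_pos_le_add fun ε hε => ?_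
    obtain ⟨-, h⟩ := key ((2 * (L : ℝ) ^ 2 * Real.log 2 + 1) / ε) (by positivity)
    have : 2 * (L : ℝ) ^ 2 * Real.log 2 / ((2 * (L : ℝ) ^ 2 * Real.log 2 + 1) / ε) ≤ ε := by
      rw [div_div_eq_mul_div, div_le_iff₀ (by positivity)]
      nlinarith
    linarith


/-! ### Secant inequalities: the levels below the chemical potential control the slope in `μ` -/

/-- Lower chemical potential, fewer filled levels: for `μ' ≤ μ`,
`Σ_k min(ε_k - μ, 0) - Σ_k min(ε_k - μ', 0) ≤ -(μ - μ') · #{k : ε_k < μ'}`. [folklore] -/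
theorem sum_min_sub_sum_min_le {μ μ' : ℝ} (h : μ' ≤ μ) :
    ∑ k : TorusSite 2 L, min (torusBand L k - μ) 0 - ∑ k : TorusSite 2 L, min (torusBand L k - μ') 0 ≤
      -(μ - μ') * ((Finset.univ.filter fun k : TorusSite 2 L => torusBand L k < μ').card : ℝ) := by
  rw [← Finset.sum_sub_distrib]
  have hterm : ∀ k : TorusSite 2 L, min (torusBand L k - μ) 0 - min (torusBand L k - μ') 0 ≤
      if torusBand L k < μ' then -(μ - μ') else 0 := by
    intro k
    split_ifs with hk
    · rw [min_eq_left (by linarith), min_eq_left (by linarith)]; linarith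
    · rw [min_eq_right (by linarith : (0 : ℝ) ≤ torusBand L k - μ'), sub_zero]
      exact min_le_right _ _
  refine (Finset.sum_le_sum fun k _ => hterm k).trans (le_of_eq ?_)
  rw [← Finset.sum_filter, Finset.sum_const, nsmul_eq_mul, mul_comm]

/-- Higher chemical potential, more filled levels: for `μ' ≤ μ`,
`-(μ - μ') · #{k : ε_k < μ} ≤ Σ_k min(ε_k - μ, 0) - Σ_k min(ε_k - μ', 0)`. [folklore] -/
theorem neg_mul_card_le_sum_min_sub_sum_min {μ μ' : ℝ} (h : μ' ≤ μ) :
    -(μ - μ') * ((Finset.univ.filter fun k : TorusSite 2 L => torusBand L k < μ).card : ℝ) ≤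
      ∑ k : TorusSite 2 L, min (torusBand L k - μ) 0 - ∑ k : TorusSite 2 L, min (torusBand L k - μ') 0 := by
  rw [← Finset.sum_sub_distrib]
  have hterm : ∀ k : TorusSite 2 L, (if torusBand L k < μ then -(μ - μ') else 0) ≤
      min (torusBand L k - μ) 0 - min (torusBand L k - μ') 0 := by
    intro k
    split_ifs with hk
    · rw [min_eq_left (by linarith)]
      have := min_le_left (torusBand L k - μ') 0
      linarith
    · rw [min_eq_right (by linarith : (0 : ℝ) ≤ torusBand L k - μ),
        min_eq_right (by linarith : (0 : ℝ) ≤ torusBand L k - μ'), sub_zero]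
  refine (le_of_eq ?_).trans (Finset.sum_le_sum fun k _ => hterm k)
  rw [← Finset.sum_filter, Finset.sum_const, nsmul_eq_mul, mul_comm]

/-- **Upper secant of the free ground energy**: for `μ' ≤ μ` and `L ≥ 3`,
`E₀(μ) ≤ E₀(μ') - 2(μ - μ') #{k : ε_k < μ'}` (raising `μ` lowers the energy at least at the rate of
the levels already filled at `μ'`). [folklore] -/
theorem groundEnergy_free_le_sub_card (hL : 3 ≤ L) {μ μ' : ℝ} (h : μ' ≤ μ) :
    (hubbardTorusWith 2 L 1 0 μ).groundEnergy ≤ (hubbardTorusWith 2 L 1 0 μ').groundEnergy -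
      2 * (μ - μ') * ((Finset.univ.filter fun k : TorusSite 2 L => torusBand L k < μ').card : ℝ) := by
  rw [groundEnergy_hubbardTorusWith_zero hL, groundEnergy_hubbardTorusWith_zero hL]
  have := sum_min_sub_sum_min_le (L := L) h
  linarith

/-- **Lower secant of the free ground energy**: for `μ' ≤ μ` and `L ≥ 3`,
`E₀(μ') ≤ E₀(μ) + 2(μ - μ') #{k : ε_k < μ}` (lowering `μ` raises the energy at most at the rate of
the levels filled at `μ`). [folklore] -/
theorem groundEnergy_free_le_add_card (hL : 3 ≤ L) {μ μ' : ℝ} (h : μ' ≤ μ) :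
    (hubbardTorusWith 2 L 1 0 μ').groundEnergy ≤ (hubbardTorusWith 2 L 1 0 μ).groundEnergy +
      2 * (μ - μ') * ((Finset.univ.filter fun k : TorusSite 2 L => torusBand L k < μ).card : ℝ) := by
  rw [groundEnergy_hubbardTorusWith_zero hL, groundEnergy_hubbardTorusWith_zero hL]
  have := neg_mul_card_le_sum_min_sub_sum_min (L := L) h
  linarith

end Literature.MathematicalPhysics.QuantumLattice

end
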